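import Literature.MathematicalPhysics.QuantumFieldTheory.Balaban1983to89.Node00.TorusCoverGaugeTokensR
import Literature.MathematicalPhysics.QuantumFieldTheory.Balaban1983to89.Node00.CarriersB8CubePrint

/-!
# NODE 00 — THE TORUS→`ℤᵈ` TWIN AT PRINT'S CUBES, FILE P1: the Proposition-6 cube of a grid cube of the record CUT TO PRINT'S CLASS
# (`CubeB8.IsPrint ρ`: collar `ρ = R₁M₁`, side a multiple of `ρ`, corner on the `ρ`-grid) — the datum `propCubeP`, its ambient member `cubeIdxP'`,
# `□♯ ⊆ 𝔔`, and the collar-projection clauses at the floor `11d + 4ρ` (repair (R-b) of record, item (b2); FILE 26's `propCube` re-cut, nothing landed edited)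

Cell `pub-ymgap`, seat `pub-ymgap-dag-n07-e` generation 15 (R141 (C) s3 «torus-vs-box twin», DAG node N07 = [15]; INTENT-36, bus 2026-08-28).  NEW leaf; CONSUMED
BY NAME, nothing modified: this seat's FILE 26 `TorusCoverCubeMember` (`constIdx`, `cubeExt_side_eq_box`, `box_subset_tcube_of_le`, `cover_mem_of_within_of_seqSeparated`),
FILE 29 `TorusCoverGaugeTokensR` (`cover_mem_hullD_one_of_within`, `boxWidth`), k0-s2-w2's `CarriersB8CubePrint` (`CubeB8.IsPrint`, item (b1), p587541),
node00-def-cube's `CubeB8`, n05-a's `box ∕ tcube`, def-R's `cubeEnl`, def-P11's `Sect2.SeqSeparated`, r15's `cover`.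
`--kind definition --supports stmt-QuantumFields-20541` (K0⁷).  [15] = [Balaban1985Variational]; [6] = [Balaban1985RegularSpaces]; [III] = [Balaban1988Convergent].

WHY (plan g79 WORDS-1 (B), bus l.24699; k0-s2-w2's located census, evidence #22 on stmt-QuantumFields-20541).  [6] Prop. 6 p. 98 is printed for cubes «of the
size R₁M₁Lʲη … M is a multiple of R₁M₁ … a distance between boundaries of these cubes is equal to R₁M₁Lʲη … for every j the cube □_j is a sum of the big blocks
of the lattice T_{L^{−j}}»; [15] (144) p. 300 builds exactly such a collared cube `□̃` around «a cube □ … of a size 2MLʲη … M ≧ R₁M₁».  FILE 26's datum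
`propCube` (collar `ρ = L`, side `M + 11d + L`, corner `M·a`) is NOT in that class for `R₁M₁ ∤ L` (k0-s2-w2: `propCube_not_printSideConditions`), and the
repaired K0⁷ stub 2′ states Proposition 6 on PRINT's class only (`zdCubP 𝔸 L ρ₀`).  THIS FILE re-cuts the datum so that it IS a print cube at big-block size
`ρ` (`ρ ≥ L` a PARAMETER — print's `R₁M₁`): corner `ρ·⌊M·a∕ρ⌋` (the grid cube's corner rounded DOWN to the `ρ`-grid), side `M′ = ρ·(⌊(M + 11d)∕ρ⌋ + 2)`
(the least convenient multiple of `ρ` with `M + 11d + ρ + 1 ≤ M′ ≤ M + 11d + 2ρ`, so that `□♯ ⊆ 𝔔` survives the corner shift and «11d < M′» holds), collar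
`ρ` EXACTLY (print's case `ρ = R₁M₁`).  The price is the collar-projection floor: every point of `𝔔̃` lies within `(11d + 4ρ)·Lⁿ` of `□♯` (FILE 26: `(11d +
3L)·Lⁿ`), so `π(𝔔̃) ⊆ Ω_{n−1}` needs `11d + 4ρ ≤ M₁` (`n ≥ 2`, print's separation) and `π(𝔔̃) ⊆ hullD M₁ 1 (Ω 1)` needs `(11d + 4ρ)·L ≤ M₁` (`n = 1`).

WHAT IS PROVED (kernel; lattice geometry and bookkeeping only — NO estimate of Bałaban).
§1 `gridFloor ρ z = ρ·(z ∕ ρ)` · `gridFloor_le` · `lt_gridFloor_add` · `dvd_gridFloor` (rounding down to the big-block grid).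
§2 `box_subset_box_of_corner` (a box inside a box with a lower corner and a longer reach) · ★ `exists_mem_box_within_of_mem_tcube_of_corner` (the clamp of
   FILE 26 for a SHIFTED corner: every point of `tcube L a′ M′ ρ n` is within `D·Lⁿ` of `box L a M n` once `a ≤ a′ − 2ρ + D` and `a′ + M′ + 2ρ ≤ a + M + D`).
§3 `cornerP` · `sideP` · `cubeIdxP'` · ★ `propCubeP P n hn M ρ (hρ : P.L ≤ ρ) a` (THE PRINT DATUM) · rfl faces · `sideP_le` ∕ `le_sideP` · ★ `isPrint_propCubeP`
   (`(propCubeP …).IsPrint ρ`, hence `IsPrint ρ₀` for every `ρ₀ ∣ ρ`) · ★ `cubeExt_subset_box_propCubeP` (`□♯ ⊆ 𝔔`).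
§4 ★ `exists_mem_box_within_of_mem_Ω_cubeIdxP'` (every level of the member is within `(11d + 4ρ)·Lⁿ` of `□♯`) · ★★ `cover_image_Ω_cubeIdxP'_subset` (`n ≥ 2`:
   `π(𝔔̃) ⊆ Ω_{n−1}` under `Sect2.SeqSeparated M₁ s` and the floor `11d + 4ρ ≤ M₁`) · ★★ `cover_image_Ω_cubeIdxP'_one_subset_hullD` (`n = 1`: `π(𝔔̃) ⊆
   hullD M₁ 1 (Ω 1)` under `(11d + 4ρ)·L ≤ M₁`) · `boxWidth_propCubeP` (`W = d·(LⁿM′ − 1)`).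
HONEST FRAMING: definitions (a corner, a side, a member, a cube datum) and lattice-geometric bookkeeping only — nothing of Bałaban asserted or discharged; stub 2′ ∕
N07 ∕ N05 ∕ K0⁷ NOT discharged; counts unmoved (5∕27); one finite T⁴ programme at fixed ε — NOT continuum ∕ ℝ⁴ ∕ infinite volume ∕ OS ∕ mass gap ∕ Clay.
No `sorry`, no `instance`, no `notation`.
-/

noncomputable section

namespace Literature.MathematicalPhysics.QuantumFieldTheory.Balaban1983to89.Node00

open scoped Matrix.Norms.L2Operator
open B15Eq112TorusCover (cover)
open B14DomainGeom (Pt Within)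
open B14.Eq213MaximalDomains (side cubeExt)
open B7Prop1Local (InBox)
open B8Ineq130 (tlo thi tlo_apply thi_apply)
open B8Eq131Cubes (box tcube tLo tHi bLo bHi)
open B8LeafModelZd (ZdIdx)

/-! ## §1  Rounding down to the big-block grid -/

section Grid

/-- **ROUNDING DOWN TO THE `ρ`-GRID**: `gridFloor ρ z = ρ·(z ∕ ρ)` (Euclidean division on `ℤ`), the largest multiple of `ρ` not exceeding `z` (`ρ > 0`) — the corner
of the print cube containing a given grid cube («for every j the cube □_j is a sum of the big blocks of the lattice T_{L^{−j}}»).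
[cite: Balaban1985RegularSpaces, p.98 («□_j is a sum of the big blocks of the lattice T_{L^{−j}}»; bookkeeping)] -/
def gridFloor (ρ : ℕ) (z : ℤ) : ℤ := (ρ : ℤ) * (z / (ρ : ℤ))

/-- `gridFloor ρ z ≤ z` (`ρ > 0`). [cite: Balaban1985RegularSpaces, p.98 (bookkeeping)] -/
theorem gridFloor_le {ρ : ℕ} (hρ : 0 < ρ) (z : ℤ) : gridFloor ρ z ≤ z := by
  have h1 := Int.mul_ediv_add_emod z (ρ : ℤ)
  have h2 := Int.emod_nonneg z (by exact_mod_cast hρ.ne' : (ρ : ℤ) ≠ 0)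
  unfold gridFloor; linarith

/-- `z < gridFloor ρ z + ρ` (`ρ > 0`). [cite: Balaban1985RegularSpaces, p.98 (bookkeeping)] -/
theorem lt_gridFloor_add {ρ : ℕ} (hρ : 0 < ρ) (z : ℤ) : z < gridFloor ρ z + ρ := by
  have h1 := Int.mul_ediv_add_emod z (ρ : ℤ)
  have h2 := Int.emod_lt_of_pos z (by exact_mod_cast hρ : (0 : ℤ) < (ρ : ℤ))
  unfold gridFloor; linarith

/-- `ρ ∣ gridFloor ρ z`. [cite: Balaban1985RegularSpaces, p.98 (bookkeeping)] -/
theorem dvd_gridFloor (ρ : ℕ) (z : ℤ) : (ρ : ℤ) ∣ gridFloor ρ z := Dvd.intro _ rfl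

end Grid

/-! ## §2  Boxes with a shifted corner -/

section Boxes

variable {d : ℕ}

/-- **A BOX INSIDE A BOX WITH A LOWER CORNER AND A LONGER REACH**: `a′ ≤ a` and `a + M ≤ a′ + M′` coordinatewise ⇒ `box L a M n ⊆ box L a′ M′ n`.
[cite: Balaban1985RegularSpaces, p.98 (bookkeeping)] -/
theorem box_subset_box_of_corner (L : ℕ) {a a' : Pt d} {M M' : ℕ} (h1 : ∀ i, a' i ≤ a i) (h2 : ∀ i, a i + (M : ℤ) ≤ a' i + (M' : ℤ)) (n : ℕ) :
    box L a M n ⊆ box L a' M' n := by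
  intro z hz i
  obtain ⟨hl, hu⟩ := hz i
  simp only [bLo, bHi, Nat.cast_zero, sub_zero, add_zero] at hl hu ⊢
  have hL : (0 : ℤ) ≤ (L : ℤ) ^ n := by positivity
  constructor
  · have := mul_le_mul_of_nonneg_left (h1 i) hL; linarith
  · have := mul_le_mul_of_nonneg_left (h2 i) hL; linarith

/-- ★ **THE CLAMP FOR A SHIFTED CORNER**: if `a ≤ a′ − 2ρ + D` and `a′ + M′ + 2ρ ≤ a + M + D` coordinatewise (`1 ≤ M`), every point of the collared cube
`tcube L a′ M′ ρ n` lies within sup-distance `D·Lⁿ` of a point of `box L a M n` — [15] (144)'s «dist(□̃, …) = 2R₁M₁Lʲη» plus the side surplus and the corner shift.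
[cite: Balaban1985Variational, (144) p.300; Balaban1985RegularSpaces, p.98] -/
theorem exists_mem_box_within_of_mem_tcube_of_corner {L : ℕ} (hL1 : 1 ≤ L) {a a' : Pt d} {M M' ρ D : ℕ} (hM : 1 ≤ M)
    (h1 : ∀ i, a i ≤ a' i - 2 * (ρ : ℤ) + (D : ℤ)) (h2 : ∀ i, a' i + (M' : ℤ) + 2 * (ρ : ℤ) ≤ a i + (M : ℤ) + (D : ℤ)) (n : ℕ) {z : Pt d}
    (hz : z ∈ tcube L a' M' ρ n) :
    ∃ y ∈ box L a M n, Within (((D * L ^ n : ℕ) : ℤ)) z y := by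
  have hL : (1 : ℤ) ≤ (L : ℤ) ^ n := by exact_mod_cast Nat.one_le_pow n L hL1
  have hL0 : (0 : ℤ) ≤ (L : ℤ) ^ n := by linarith
  -- the clamp of `z` into the box `[lo, hi]`, `lo = Lⁿ·a`, `hi = Lⁿ·(a + M) − 1`
  set lo : Pt d := fun i => (L : ℤ) ^ n * a i with hlo
  set hi : Pt d := fun i => (L : ℤ) ^ n * (a i + M) - 1 with hhi
  have hlohi : ∀ i, lo i ≤ hi i := fun i => by
    simp only [hlo, hhi]
    have : (L : ℤ) ^ n * a i + (L : ℤ) ^ n * 1 ≤ (L : ℤ) ^ n * (a i + M) := by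
      rw [← mul_add]; exact mul_le_mul_of_nonneg_left (by omega) hL0
    linarith
  refine ⟨fun i => max (lo i) (min (z i) (hi i)), fun i => ?_, fun i => ?_⟩
  · simp only [bLo, bHi, Nat.cast_zero, sub_zero, add_zero]
    exact ⟨le_max_left _ _, max_le (hlohi i) (min_le_right _ _)⟩
  · dsimp only
    obtain ⟨hz1, hz2⟩ := hz i
    rw [tlo_apply] at hz1
    rw [thi_apply] at hz2
    simp only [tLo, tHi] at hz1 hz2
    have hcast : ((((D * L ^ n : ℕ) : ℤ))) = (D : ℤ) * (L : ℤ) ^ n := by push_cast; ring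
    rw [hcast, abs_le]
    have hlo_z : lo i - z i ≤ (D : ℤ) * (L : ℤ) ^ n := by
      have e1 : lo i - (L : ℤ) ^ n * (a' i - 2 * ρ) = (L : ℤ) ^ n * (a i - a' i + 2 * ρ) := by simp only [hlo]; ring
      have e2 : (L : ℤ) ^ n * (a i - a' i + 2 * ρ) ≤ (L : ℤ) ^ n * D := mul_le_mul_of_nonneg_left (by linarith [h1 i]) hL0
      linarith
    have hz_hi : z i - hi i ≤ (D : ℤ) * (L : ℤ) ^ n := by
      have e1 : ((L : ℤ) ^ n * (a' i + M' - 1 + 2 * ρ + 1) - 1) - hi i = (L : ℤ) ^ n * (a' i + M' + 2 * ρ - a i - M) := by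
        simp only [hhi]; ring
      have e2 : (L : ℤ) ^ n * (a' i + M' + 2 * ρ - a i - M) ≤ (L : ℤ) ^ n * D := mul_le_mul_of_nonneg_left (by linarith [h2 i]) hL0
      linarith
    constructor
    · rcases le_total (lo i) (z i) with hc | hc
      · have hy : max (lo i) (min (z i) (hi i)) ≤ z i := max_le hc (min_le_left _ _)
        linarith
      · have hy : max (lo i) (min (z i) (hi i)) ≤ lo i := max_le le_rfl ((min_le_left _ _).trans hc)
        linarith
    · rcases le_total (z i) (hi i) with hc | hc
      · have hy : z i ≤ max (lo i) (min (z i) (hi i)) := by rw [min_eq_left hc]; exact le_max_right _ _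
        have : (0 : ℤ) ≤ (D : ℤ) * (L : ℤ) ^ n := mul_nonneg (by positivity) hL0
        linarith
      · have hy : hi i ≤ max (lo i) (min (z i) (hi i)) := by rw [min_eq_right hc]; exact le_max_right _ _
        linarith

end Boxes

/-! ## §3  The print datum of a grid cube: corner on the `ρ`-grid, side a multiple of `ρ`, collar `ρ` -/

section Member

variable (P : Params)

/-- **THE PRINT CORNER**: the corner `M·a` of the grid cube `□ = cubeEnl P (LⁿM) a 0` (in `Lⁿ`-blocks) rounded down to the `ρ`-grid.
[cite: Balaban1985RegularSpaces, p.98 («□_j is a sum of the big blocks»); Balaban1985Variational, (144) p.300] -/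
def cornerP (M ρ : ℕ) (a : Pt P.d) : Pt P.d := fun i => gridFloor ρ ((M : ℤ) * a i)

/-- **THE PRINT SIDE** `M′ = ρ·(⌊(M + 11d)∕ρ⌋ + 2)`: a multiple of `ρ` («M is a multiple of R₁M₁») with `M + 11d + ρ + 1 ≤ M′ ≤ M + 11d + 2ρ` — room for the
grid cube after the corner shift (`< ρ`), for (1.130)'s «11d < M», and no more. [cite: Balaban1985RegularSpaces, p.98 («M is a multiple of R₁M₁»), (1.130) p.99] -/
def sideP (M ρ : ℕ) : ℕ := ρ * ((M + 11 * P.d) / ρ + 2)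

variable {P} in
/-- `M′ ≤ M + 11d + 2ρ`. [cite: Balaban1985RegularSpaces, p.98 (bookkeeping)] -/
theorem sideP_le (M ρ : ℕ) : sideP P M ρ ≤ M + 11 * P.d + 2 * ρ := by
  unfold sideP
  have := Nat.mul_div_le (M + 11 * P.d) ρ
  rw [mul_add]; omega

variable {P} in
/-- `M + 11d + ρ + 1 ≤ M′` (`ρ > 0`). [cite: Balaban1985RegularSpaces, p.98 (bookkeeping)] -/
theorem le_sideP (M : ℕ) {ρ : ℕ} (hρ : 0 < ρ) : M + 11 * P.d + ρ + 1 ≤ sideP P M ρ := by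
  unfold sideP
  have := Nat.lt_mul_div_succ (M + 11 * P.d) hρ
  rw [mul_add] at this ⊢
  omega

/-- **THE AMBIENT MEMBER OF A GRID CUBE AT PRINT'S COLLAR** `□ = cubeEnl P (LⁿM) a 0` of scale `n ≥ 1`: spacing `η_n = L⁻ⁿ`, `n` levels, all equal to the collared
print cube `𝔔̃ = tcube L (cornerP) (sideP) ρ n` (FILE 26's `constIdx`). [cite: Balaban1985Variational, (144) p.300; Balaban1985RegularSpaces, p.98, (1.3)–(1.5) p.77] -/
def cubeIdxP' (n : ℕ) (hn : 1 ≤ n) (M ρ : ℕ) (a : Pt P.d) : ZdIdx P.d P.L :=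
  constIdx P.L (P.eta n) (B3GkZeroTorusRescaled.eta_pos P n) n hn (tcube P.L (cornerP P M ρ a) (sideP P M ρ) ρ n)

/-- ★ **THE PRINT DATUM `𝔔` OF A GRID CUBE** as a `Node00.CubeB8` datum of the member `cubeIdxP' P n hn M ρ a`: scale `k := n`, corner `cornerP` (on the `ρ`-grid),
side `sideP` (a multiple of `ρ`, «11d < M′»), collar `ρ` EXACTLY — print's cube of [6] p. 98 ∕ [15] (144) at big-block size `ρ = R₁M₁ ≥ L` («□ ⊂ Ω_k», «□̃ ⊂
Ω_{k−1}» by construction: every level of the member is `𝔔̃ ⊇ 𝔔`). [cite: Balaban1985RegularSpaces, p.98, (1.130) p.99, Prop. 6 p.99; Balaban1985Variational, (144) p.300] -/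
def propCubeP (n : ℕ) (hn : 1 ≤ n) (M ρ : ℕ) (hρ : P.L ≤ ρ) (a : Pt P.d) :
    CubeB8 P.d P.L (cubeIdxP' P n hn M ρ a).k (cubeIdxP' P n hn M ρ a).Ω where
  k := n
  a := cornerP P M ρ a
  M := sideP P M ρ
  ρ := ρ
  one_le_k := hn
  k_le := le_rfl
  L_le_ρ := hρ
  ρ_le_M := Nat.le_mul_of_pos_right ρ (Nat.succ_pos _)
  big := by have := le_sideP (P := P) M (lt_of_lt_of_le P.L_pos hρ); omega
  L_le_dM := by
    have hd := P.hd
    have h1 : P.L ≤ sideP P M ρ := hρ.trans (Nat.le_mul_of_pos_right ρ (Nat.succ_pos _))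
    calc P.L ≤ sideP P M ρ := h1
      _ = 1 * sideP P M ρ := (one_mul _).symm
      _ ≤ P.d * sideP P M ρ := Nat.mul_le_mul_right _ hd
  box_sub := box_subset_tcube_of_le P.L _ le_rfl ρ n
  tcube_sub := le_rfl

/-- The datum's scale index is `n`. [cite: Balaban1985RegularSpaces, Prop. 6 p.99 (bookkeeping)] -/
@[simp] theorem propCubeP_k (n : ℕ) (hn : 1 ≤ n) (M ρ : ℕ) (hρ : P.L ≤ ρ) (a : Pt P.d) : (propCubeP P n hn M ρ hρ a).k = n := rfl

/-- The datum's side is `M′ = sideP P M ρ`. [cite: Balaban1985RegularSpaces, (1.130) p.99 (bookkeeping)] -/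
@[simp] theorem propCubeP_M (n : ℕ) (hn : 1 ≤ n) (M ρ : ℕ) (hρ : P.L ≤ ρ) (a : Pt P.d) : (propCubeP P n hn M ρ hρ a).M = sideP P M ρ := rfl

/-- The datum's collar width is `ρ` (print's `R₁M₁`, exactly). [cite: Balaban1985RegularSpaces, p.98 (bookkeeping)] -/
@[simp] theorem propCubeP_ρ (n : ℕ) (hn : 1 ≤ n) (M ρ : ℕ) (hρ : P.L ≤ ρ) (a : Pt P.d) : (propCubeP P n hn M ρ hρ a).ρ = ρ := rfl

/-- The datum's corner is `cornerP P M ρ a`. [cite: Balaban1985RegularSpaces, p.98 (bookkeeping)] -/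
@[simp] theorem propCubeP_a (n : ℕ) (hn : 1 ≤ n) (M ρ : ℕ) (hρ : P.L ≤ ρ) (a : Pt P.d) : (propCubeP P n hn M ρ hρ a).a = cornerP P M ρ a := rfl

/-- The member's levels are the datum's collared cube `𝔔̃ = tcube L (cornerP) (sideP) ρ n`. [cite: Balaban1985RegularSpaces, p.98 (bookkeeping)] -/
theorem cubeIdxP'_Ω (n : ℕ) (hn : 1 ≤ n) (M ρ : ℕ) (a : Pt P.d) (j : ℕ) :
    (cubeIdxP' P n hn M ρ a).Ω j = tcube P.L (cornerP P M ρ a) (sideP P M ρ) ρ n := rfl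

/-- The member's spacing is `η_n`. [cite: Balaban1987RG1, (1.1) p.260 (bookkeeping)] -/
theorem cubeIdxP'_η (n : ℕ) (hn : 1 ≤ n) (M ρ : ℕ) (a : Pt P.d) : (cubeIdxP' P n hn M ρ a).η = P.eta n := rfl

/-- The member has `n` levels. [cite: Balaban1985RegularSpaces, (1.3) p.77 (bookkeeping)] -/
theorem cubeIdxP'_k (n : ℕ) (hn : 1 ≤ n) (M ρ : ℕ) (a : Pt P.d) : (cubeIdxP' P n hn M ρ a).k = n := rfl

/-- ★ **THE DATUM IS A PRINT CUBE AT BIG-BLOCK SIZE `ρ`** (`ρ ∣ ρ`, `ρ ∣ M′`, corner on the `ρ`-grid) — hence at every `ρ₀ ∣ ρ` (`CubeB8.IsPrint.of_dvd`).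
[cite: Balaban1985RegularSpaces, p.98 («M is a multiple of R₁M₁ … distance … equal to R₁M₁Lʲη … □_j is a sum of the big blocks»)] -/
theorem isPrint_propCubeP (n : ℕ) (hn : 1 ≤ n) (M ρ : ℕ) (hρ : P.L ≤ ρ) (a : Pt P.d) : (propCubeP P n hn M ρ hρ a).IsPrint ρ :=
  ⟨dvd_rfl, Dvd.intro _ rfl, fun _ => dvd_gridFloor ρ _⟩

/-- ★ **`□♯ ⊆ 𝔔`**: the lift `cubeExt (LⁿM) a 0 = box L (M·a) M n` of the grid cube lies in the print datum's cube `box L (cornerP) (sideP) n` (the corner moved down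
by `< ρ`, the side grew by `≥ 11d + ρ + 1`). [cite: Balaban1985Variational, (144) p.300 («□_k ⊃ □»); Balaban1985RegularSpaces, p.98] -/
theorem cubeExt_subset_box_propCubeP (n : ℕ) (hn : 1 ≤ n) (M ρ : ℕ) (hρ : P.L ≤ ρ) (a : Pt P.d) :
    cubeExt (side P.L M n) a 0 ⊆ box P.L (propCubeP P n hn M ρ hρ a).a (propCubeP P n hn M ρ hρ a).M (propCubeP P n hn M ρ hρ a).k := by
  have hρ0 : 0 < ρ := lt_of_lt_of_le P.L_pos hρ
  rw [cubeExt_side_eq_box]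
  refine box_subset_box_of_corner P.L (fun i => gridFloor_le hρ0 _) (fun i => ?_) n
  simp only [propCubeP_M]
  have h1 := lt_gridFloor_add hρ0 ((M : ℤ) * a i)
  have h2 : ((M + 11 * P.d + ρ + 1 : ℕ) : ℤ) ≤ ((sideP P M ρ : ℕ) : ℤ) := by exact_mod_cast le_sideP (P := P) M hρ0
  push_cast at h2
  linarith

end Member

/-! ## §4  The collar of the print datum projects into `Ω_{n−1}` (floor `11d + 4ρ`) ∕ into the support (floor `(11d + 4ρ)·L`); the width -/

section Collar

variable {P : Params}

/-- ★ **EVERY LEVEL OF THE MEMBER IS WITHIN `(11d + 4ρ)·Lⁿ` OF `□♯`**: a point of `𝔔̃ = tcube L (cornerP) (sideP) ρ n` lies within sup-distance `(11d + 4ρ)·Lⁿ` of a point of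
`box L (M·a) M n = □♯` (`1 ≤ M`, `L ≤ ρ`): lower side `< ρ + 2ρ`, upper side `≤ (11d + 2ρ) + 2ρ`. [cite: Balaban1985Variational, (144) p.300; Balaban1985RegularSpaces, p.98] -/
theorem exists_mem_box_within_of_mem_Ω_cubeIdxP' {n : ℕ} (hn : 1 ≤ n) {M ρ : ℕ} (hM : 1 ≤ M) (hρ : P.L ≤ ρ) (a : Pt P.d) {j : ℕ} {z : Pt P.d}
    (hz : z ∈ (cubeIdxP' P n hn M ρ a).Ω j) :
    ∃ y ∈ box P.L (fun i => (M : ℤ) * a i) M n, Within ((((11 * P.d + 4 * ρ) * P.L ^ n : ℕ) : ℤ)) z y := by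
  have hρ0 : 0 < ρ := lt_of_lt_of_le P.L_pos hρ
  rw [cubeIdxP'_Ω] at hz
  refine exists_mem_box_within_of_mem_tcube_of_corner P.L_pos hM (fun i => ?_) (fun i => ?_) n hz
  · simp only [cornerP]
    have h1 := lt_gridFloor_add hρ0 ((M : ℤ) * a i)
    push_cast
    linarith
  · simp only [cornerP]
    have h1 := gridFloor_le hρ0 ((M : ℤ) * a i)
    have h2 : ((sideP P M ρ : ℕ) : ℤ) ≤ ((M + 11 * P.d + 2 * ρ : ℕ) : ℤ) := by exact_mod_cast sideP_le (P := P) M ρ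
    push_cast at h2 ⊢
    linarith

/-- ★★ **[15] (144) ∕ [6] p. 98 «□̃ ⊂ Ω_{k−1}» FOR THE PRINT DATUM OF A GRID CUBE `□ ⊆ Ω_n`, ON THE COVER** (`2 ≤ n ≤ k`, `1 ≤ M`, separated sequence): every level of
the member `cubeIdxP'` projects into `Ω_{n−1}` under the floor `11d + 4ρ ≤ M₁` (the print collar `2ρ`, the corner shift `< ρ` and the side surplus `≤ 11d + 2ρ` must
fit in print's separation layer `LⁿM₁`). [cite: Balaban1985Variational, (144) p.300 («□̃ ⊂ B_{j−1}(Λ_{j−1}) ∪ B_j(Λ_j)»); Balaban1985RegularSpaces, p.98 («□̃ ⊂ Ω_{k−1}»), (1.3)–(1.6) p.77] -/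
theorem cover_image_Ω_cubeIdxP'_subset {D : ℕ → Set (Set (Site P 0))} {k : ℕ} {M₁ : ℕ} (s : B14.Eq218Concrete.Seq D k)
    (hsep : Sect2.SeqSeparated M₁ s) {ρ : ℕ} (hρ : P.L ≤ ρ) (hfloor : 11 * P.d + 4 * ρ ≤ M₁) {n : ℕ} (hn : 2 ≤ n) (hnk : n ≤ k) {M : ℕ} (hM : 1 ≤ M)
    (a : Pt P.d) (hΩ : cubeEnl P (side P.L M n) a 0 ⊆ s.Ω n) (j : ℕ) :
    cover P '' (cubeIdxP' P n (by omega) M ρ a).Ω j ⊆ s.Ω (n - 1) := by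
  rintro _ ⟨z, hz, rfl⟩
  have hM₁ : 1 ≤ M₁ := le_trans (by have := P.hd; omega) hfloor
  obtain ⟨y, hy, hzy⟩ := exists_mem_box_within_of_mem_Ω_cubeIdxP' (by omega) hM hρ a hz
  have hy' : cover P y ∈ s.Ω n := by
    refine hΩ ⟨y, ?_, rfl⟩
    simp only [Nat.zero_mul, Nat.cast_zero]
    rw [cubeExt_side_eq_box]
    exact hy
  obtain ⟨m, rfl⟩ : ∃ m, n = m + 1 := ⟨n - 1, by omega⟩
  rw [Nat.add_sub_cancel]
  refine cover_mem_of_within_of_seqSeparated hM₁ s hsep (by omega) (by omega) hy' fun i => (hzy i).trans ?_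
  rw [side]
  have hL : (0 : ℤ) ≤ (P.L : ℤ) ^ (m + 1) := by positivity
  push_cast
  nlinarith

/-- ★★ **AT SCALE `n = 1` THE COLLAR OF THE PRINT DATUM PROJECTS INTO THE SUPPORT OF RECORD** `hullD M₁ 1 (Ω 1)` ([III] p. 255: `Ω₁` + one layer of scale-0
`M₁`-cubes), under the floor `(11d + 4ρ)·L ≤ M₁` (`□ = cubeEnl P (L·M) a 0 ⊆ Ω 1`, `1 ≤ M`). [cite: Balaban1988Convergent, p.255; Balaban1985Variational, (144) p.300; Balaban1985RegularSpaces, p.98] -/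
theorem cover_image_Ω_cubeIdxP'_one_subset_hullD {M₁ ρ : ℕ} (hρ : P.L ≤ ρ) (hfloor : (11 * P.d + 4 * ρ) * P.L ≤ M₁) {Ω : ℕ → Set (Site P 0)} {M : ℕ}
    (hM : 1 ≤ M) (a : Pt P.d) (hΩ : cubeEnl P (side P.L M 1) a 0 ⊆ Ω 1) (j : ℕ) :
    cover P '' (cubeIdxP' P 1 le_rfl M ρ a).Ω j ⊆ hullD P M₁ 1 (Ω 1) := by
  rintro _ ⟨z, hz, rfl⟩
  have hL := P.hL.2
  have hM₁ : 0 < M₁ := lt_of_lt_of_le (by have := P.hd; nlinarith) hfloor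
  obtain ⟨y, hy, hzy⟩ := exists_mem_box_within_of_mem_Ω_cubeIdxP' le_rfl hM hρ a hz
  have hy' : cover P y ∈ Ω 1 := by
    refine hΩ ⟨y, ?_, rfl⟩
    simp only [Nat.zero_mul, Nat.cast_zero]
    rw [cubeExt_side_eq_box]; exact hy
  refine cover_mem_hullD_one_of_within hM₁ hy' fun i => (hzy i).trans ?_
  rw [pow_one]; exact_mod_cast hfloor

/-- The total width of the print datum `𝔔`: `W = d·(LⁿM′ − 1)`. [cite: Balaban1985RegularSpaces, p.98 (bookkeeping)] -/
theorem boxWidth_propCubeP (P : Params) (n : ℕ) (hn : 1 ≤ n) (M ρ : ℕ) (hρ : P.L ≤ ρ) (a : Pt P.d) :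
    boxWidth (bLo P.L (propCubeP P n hn M ρ hρ a).a (propCubeP P n hn M ρ hρ a).k 0)
        (bHi P.L (propCubeP P n hn M ρ hρ a).a (propCubeP P n hn M ρ hρ a).M (propCubeP P n hn M ρ hρ a).k 0) =
      P.d * ((P.L : ℝ) ^ n * ((sideP P M ρ : ℕ) : ℝ) - 1) := by
  simp only [boxWidth, propCubeP_a, propCubeP_M, propCubeP_k, bLo, bHi, Nat.cast_zero, sub_zero, add_zero]
  have : ∀ μ : Fin P.d, (((P.L : ℤ) ^ n * (cornerP P M ρ a μ + ((sideP P M ρ : ℕ) : ℤ)) - 1 - (P.L : ℤ) ^ n * cornerP P M ρ a μ : ℤ) : ℝ) =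
      (P.L : ℝ) ^ n * ((sideP P M ρ : ℕ) : ℝ) - 1 := fun μ => by push_cast; ring
  rw [Finset.sum_congr rfl fun μ _ => this μ, Finset.sum_const, Finset.card_univ, Fintype.card_fin, nsmul_eq_mul]

end Collar

end Literature.MathematicalPhysics.QuantumFieldTheory.Balaban1983to89.Node00

end
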